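import Summits.PneNP.PneNP.Theorems.EfNotPOptimalEFProofSearchOfCollapseBricks
import HarnessLib

/-!
# EF proof search under `P = NP` (item `EFProofSearchOfCollapse`), IV: the certificate checker is polynomial-time and sound

Support file 4/5 for stmt-PneNP-18943. A certificate for the code word `x = encode φ` is
`y = ⟨A, B⟩`: `A` a list of extension items `⟨1ʲ, encode ψ_j⟩`, `B` a list of code words of lines.
`chkFn F` (defined in `…Defs`; a conjunction of one-bit `FP` tests on `⟨x, y⟩`, every list
re-encoded first so that all bricks read genuine list codes): (C2) every item carries a formula code
word (`cwFn`) whose variables have numerals of length `≤ |x| + j`; (C3) the indices increase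
strictly (`chainFn`); (C4) every line is a formula code word; (C5) the unit-table Cook–Reckhow
translation (`translFn`) of "extension lines ++ lines" is longer than that of the extension lines by
exactly the number of lines — i.e. every line is inferred; (C6) the last line is `x`.
`chkFn_mem_FP`; `sound_chkFn`: an accepted certificate decodes (`extractProof`) to an extended-Frege
proof of `φ` over `F`, whose `listBool` code is computed by `fullFn ∈ FP`.

References: S. A. Cook, R. A. Reckhow, *The relative efficiency of propositional proof systems*,
JSL 44 (1979), §1 (Def. 1.5: the class `𝓛` of polynomial-time functions), §2 (Lemma 2.5, Thm. 2.3),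
§4 (Def. 4.1: the extension rule); J. Krajíček, *Bounded arithmetic, propositional logic, and
complexity theory* (CUP 1995), Def. 4.5.2; S. Arora, B. Barak, *Computational Complexity* (CUP 2009),
Thm. 2.18 (decision versus search).
-/

set_option linter.dupNamespace false

namespace Summit.PneNP.PneNP.Theorems.EFProofSearch

open _root_.Computability Literature.Computability.Complexity Literature.Computability.MetaComplexity
open Literature.Barriers.QuantumAdvantage.TQBFEval (varOcc)

/-! ## The certificate checker: assembly, soundness, acceptance of normal-form certificates -/

section Checker

open Brick FregeTransl
open Literature.Barriers.QuantumAdvantage.TQBFEval (cwFn cwFn_mem_FP cwFn_eq_true_iff cwFn_encode oneBit_cwFn)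

/-! ### Reading the input `⟨x, ⟨A, B⟩⟩` -/

/-- `xAFn ∈ FP`. -/
theorem xAFn_mem_FP : xAFn ∈ FP :=
  fanoutFn_mem_FP fstF_mem_FP (comp_mem_FP (mapCtxFn_mem_FP sndF_mem_FP length_sndF_le_mapGrowth)
    (fanoutFn_mem_FP fstF_mem_FP (comp_mem_FP fstF_mem_FP sndF_mem_FP)))

/-- `xBFn ∈ FP`. -/
theorem xBFn_mem_FP : xBFn ∈ FP :=
  fanoutFn_mem_FP fstF_mem_FP (comp_mem_FP (mapCtxFn_mem_FP sndF_mem_FP length_sndF_le_mapGrowth)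
    (fanoutFn_mem_FP fstF_mem_FP (comp_mem_FP sndF_mem_FP sndF_mem_FP)))

/-- Re-encoding the items of a string gives a genuine list code with the same items. -/
theorem mapCtxFn_sndF (x L : List Bool) : mapCtxFn sndF (boolPair x L) = encList (decNil L) := by
  rw [mapCtxFn_boolPair]; simp

/-- Value of `xAFn`. -/
theorem xAFn_boolPair (x y : List Bool) : xAFn (boolPair x y) = boolPair x (encList (decNil (fstF y))) := by
  simp [xAFn, mapCtxFn_sndF]

/-- Value of `xBFn`. -/
theorem xBFn_boolPair (x y : List Bool) : xBFn (boolPair x y) = boolPair x (encList (decNil (sndF y))) := by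
  simp [xBFn, mapCtxFn_sndF]

/-! ### The five tests -/

/-- `eItemFn ∈ FP`. -/
theorem eItemFn_mem_FP : eItemFn ∈ FP :=
  andFn_mem_FP (comp_mem_FP cwFn_mem_FP (comp_mem_FP sndF_mem_FP sndF_mem_FP)) vbFn_mem_FP

/-- `eItemFn` is one-bit. -/
theorem oneBit_eItemFn : OneBit eItemFn := oneBit_andFn ((oneBit_cwFn.comp _)) oneBit_vbFn

/-- `idxLtFn ∈ FP`. -/
theorem idxLtFn_mem_FP : idxLtFn ∈ FP :=
  comp_mem_FP ltLenF_mem_FP (fanoutFn_mem_FP (comp_mem_FP fstF_mem_FP (comp_mem_FP fstF_mem_FP sndF_mem_FP))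
    (comp_mem_FP fstF_mem_FP (comp_mem_FP sndF_mem_FP sndF_mem_FP)))

/-- `idxLtFn` is one-bit. -/
theorem oneBit_idxLtFn : OneBit idxLtFn := oneBit_ltLenF.comp _

/-- Value of `idxLtFn`. -/
theorem idxLtFn_apply (x a b : List Bool) :
    idxLtFn (boolPair x (boolPair a b)) = [decide ((fstF a).length < (fstF b).length)] := by
  simp [idxLtFn]

/-- `cntAFn ∈ FP`. -/
theorem cntAFn_mem_FP : cntAFn ∈ FP :=
  comp_mem_FP (foldFn_mem_FP (comp_mem_FP (cons_mem_FP true) (sndPow_mem_FP 1)) (const_mem_FP _) foldGrowth_consTrue)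
    xAFn_mem_FP

/-- `cntBFn ∈ FP`. -/
theorem cntBFn_mem_FP : cntBFn ∈ FP :=
  comp_mem_FP (foldFn_mem_FP (comp_mem_FP (cons_mem_FP true) (sndPow_mem_FP 1)) (const_mem_FP _) foldGrowth_consTrue)
    xBFn_mem_FP

/-- `elFn ∈ FP`. -/
theorem elFn_mem_FP : elFn ∈ FP := comp_mem_FP (mapCtxFn_mem_FP mkExtFn_mem_FP length_mkExtFn_le) xAFn_mem_FP

/-- `fullFn ∈ FP`. -/
theorem fullFn_mem_FP : fullFn ∈ FP :=
  fanoutFn_mem_FP (append_mem_FP cntAFn_mem_FP cntBFn_mem_FP)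
    (append_mem_FP elFn_mem_FP (comp_mem_FP sndF_mem_FP xBFn_mem_FP))

/-- `eOnlyFn ∈ FP`. -/
theorem eOnlyFn_mem_FP : eOnlyFn ∈ FP := fanoutFn_mem_FP cntAFn_mem_FP elFn_mem_FP

/-- **`chkFn F ∈ FP`.** -/
theorem chkFn_mem_FP (F : FregeSystem) : chkFn F ∈ FP := by
  refine andFn_mem_FP (comp_mem_FP (allFn_mem_FP eItemFn_mem_FP oneBit_eItemFn) xAFn_mem_FP)
    (andFn_mem_FP (comp_mem_FP (chainFn_mem_FP idxLtFn_mem_FP oneBit_idxLtFn) xAFn_mem_FP)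
    (andFn_mem_FP (comp_mem_FP (allFn_mem_FP (comp_mem_FP cwFn_mem_FP sndF_mem_FP) (oneBit_cwFn.comp _)) xBFn_mem_FP)
    (andFn_mem_FP ?_ ?_)))
  · exact comp_mem_FP eqPairFn_mem_FP (fanoutFn_mem_FP
      (comp_mem_FP fstF_mem_FP (comp_mem_FP (translFn_mem_FP _ _) fullFn_mem_FP))
      (append_mem_FP (comp_mem_FP fstF_mem_FP (comp_mem_FP (translFn_mem_FP _ _) eOnlyFn_mem_FP))
        cntBFn_mem_FP))
  · exact comp_mem_FP eqPairFn_mem_FP (fanoutFn_mem_FP (comp_mem_FP lastItemFn_mem_FP xBFn_mem_FP) fstF_mem_FP)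

/-- The five tests are one-bit. -/
theorem oneBit_tests (F : FregeSystem) :
    OneBit c2Fn ∧ OneBit c3Fn ∧ OneBit c4Fn ∧ OneBit (c5Fn F) ∧ OneBit c6Fn :=
  ⟨(oneBit_allFn oneBit_eItemFn).comp _, (oneBit_chainFn _).comp _, (oneBit_allFn (oneBit_cwFn.comp _)).comp _,
    oneBit_eqPairFn.comp _, oneBit_eqPairFn.comp _⟩

/-- **`chkFn F` is one-bit** (so `{z | chkFn F z = [1]}` is a language decided by it). -/
theorem oneBit_chkFn (F : FregeSystem) : OneBit (chkFn F) := by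
  obtain ⟨h2, h3, h4, h5, h6⟩ := oneBit_tests F
  exact oneBit_andFn h2 (oneBit_andFn h3 (oneBit_andFn h4 (oneBit_andFn h5 h6)))

/-- Truth of the checker: all five tests pass. -/
theorem chkFn_eq_true_iff (F : FregeSystem) (z : List Bool) :
    chkFn F z = [true] ↔ c2Fn z = [true] ∧ c3Fn z = [true] ∧ c4Fn z = [true] ∧ c5Fn F z = [true] ∧ c6Fn z = [true] := by
  obtain ⟨h2, h3, h4, h5, h6⟩ := oneBit_tests F
  rw [chkFn, andFn_eq_true_iff h2 (oneBit_andFn h3 (oneBit_andFn h4 (oneBit_andFn h5 h6))),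
    andFn_eq_true_iff h3 (oneBit_andFn h4 (oneBit_andFn h5 h6)), andFn_eq_true_iff h4 (oneBit_andFn h5 h6),
    andFn_eq_true_iff h5 h6]

/-! ### Decoding a certificate -/

/-- `decodeForm` inverts `encode`. -/
theorem decodeForm_encode (ψ : PropForm ℕ) : decodeForm (encodingPropForm.encode ψ) = ψ := by
  simp [decodeForm, encodingPropForm.decode_encode]

/-! ### Soundness of the tests -/

/-- C2 ⇒ every extension item carries a formula code word with short variables. -/
theorem sound_c2 {x y : List Bool} (h : c2Fn (boolPair x y) = [true]) :
    ∀ a ∈ decNil (fstF y), sndF a = encodingPropForm.encode (decodeForm (sndF a)) ∧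
      ∀ v ∈ (decodeForm (sndF a)).vars, (encodeNat v).length ≤ x.length + (fstF a).length := by
  rw [c2Fn, Function.comp_apply, xAFn_boolPair, allFn_boolPair_eq_true oneBit_eItemFn, decNil_encList] at h
  intro a ha
  have h1 := h a ha
  rw [eItemFn, andFn_eq_true_iff (oneBit_cwFn.comp _) oneBit_vbFn] at h1
  obtain ⟨hcw, hvb⟩ := h1
  have hcw' : cwFn (sndF a) = [true] := by simpa using hcw
  obtain ⟨ψ, hψ⟩ := (cwFn_eq_true_iff _).1 hcw'
  have hdec : decodeForm (sndF a) = ψ := by rw [← hψ, decodeForm_encode]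
  rw [hdec]
  exact ⟨hψ.symm, (vbFn_eq_true_iff hψ.symm).1 hvb⟩

/-- C3 ⇒ the indices of the items increase strictly. -/
theorem sound_c3 {x y : List Bool} (h : c3Fn (boolPair x y) = [true]) :
    (itemsOf y).Pairwise (fun a b => a.1 < b.1) := by
  rw [c3Fn, Function.comp_apply, xAFn_boolPair, chainFn_encList_eq_true oneBit_idxLtFn] at h
  simp only [idxLtFn_apply, List.cons.injEq, and_true, decide_eq_true_eq] at h
  haveI : IsTrans (List Bool) (fun a b => (fstF a).length < (fstF b).length) := ⟨fun _ _ _ => lt_trans⟩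
  have hp := (List.isChain_iff_pairwise).1 h
  rw [itemsOf, List.pairwise_map]
  exact hp.imp fun hab => hab

/-- C4 ⇒ every line is a formula code word. -/
theorem sound_c4 {x y : List Bool} (h : c4Fn (boolPair x y) = [true]) :
    ∀ b ∈ decNil (sndF y), b = encodingPropForm.encode (decodeForm b) := by
  rw [c4Fn, Function.comp_apply, xBFn_boolPair, allFn_boolPair_eq_true (oneBit_cwFn.comp _), decNil_encList] at h
  intro b hb
  have h1 : cwFn b = [true] := by simpa using h b hb
  obtain ⟨ψ, hψ⟩ := (cwFn_eq_true_iff _).1 h1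
  rw [← hψ, decodeForm_encode]

/-- Under C2, `elFn` is the list code of the canonical extension lines. -/
theorem elFn_eq {x y : List Bool}
    (h2 : ∀ a ∈ decNil (fstF y), sndF a = encodingPropForm.encode (decodeForm (sndF a))) :
    elFn (boolPair x y) = encList (((itemsOf y).map (extLine x.length)).map encodingPropForm.encode) := by
  rw [elFn, Function.comp_apply, xAFn_boolPair, mapCtxFn_boolPair, decNil_encList, itemsOf, List.map_map,
    List.map_map]
  refine congrArg encList (List.map_congr_left fun a ha => ?_)
  simp only [Function.comp_apply]
  exact mkExtFn_apply (h2 a ha)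

/-- Under C4, `plFn` is the list code of the lines. -/
theorem plFn_eq {x y : List Bool} (h4 : ∀ b ∈ decNil (sndF y), b = encodingPropForm.encode (decodeForm b)) :
    plFn (boolPair x y) = encList ((linesOf y).map encodingPropForm.encode) := by
  rw [plFn, Function.comp_apply, xBFn_boolPair, sndF_boolPair, linesOf, List.map_map]
  refine congrArg encList ?_
  conv_lhs => rw [← List.map_id (decNil (sndF y))]
  exact List.map_congr_left fun b hb => by simpa using h4 b hb

/-- Value of the counters. -/
theorem cntAFn_boolPair (x y : List Bool) : cntAFn (boolPair x y) = List.replicate (itemsOf y).length true := by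
  rw [cntAFn, Function.comp_apply, xAFn_boolPair, ucountFn_boolPair, decNil_encList, itemsOf, List.length_map]

/-- Value of the counters. -/
theorem cntBFn_boolPair (x y : List Bool) : cntBFn (boolPair x y) = List.replicate (linesOf y).length true := by
  rw [cntBFn, Function.comp_apply, xBFn_boolPair, ucountFn_boolPair, decNil_encList, linesOf, List.length_map]

/-- **Under C2 and C4, `fullFn` computes the `listBool` code of the extracted proof.** -/
theorem fullFn_eq {x y : List Bool}
    (h2 : ∀ a ∈ decNil (fstF y), sndF a = encodingPropForm.encode (decodeForm (sndF a)))
    (h4 : ∀ b ∈ decNil (sndF y), b = encodingPropForm.encode (decodeForm b)) :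
    fullFn (boolPair x y) = encodingPropForm.listBool.encode (extractProof x y) := by
  rw [FregeTransl.listBool_encode_eq, fullFn, fanoutFn_apply, cntAFn_boolPair, cntBFn_boolPair, elFn_eq h2, plFn_eq h4,
    extractProof, List.length_append, List.length_map, List.replicate_add, List.map_append, encList_append]

/-- Under C2, `eOnlyFn` computes the `listBool` code of the extension lines. -/
theorem eOnlyFn_eq {x y : List Bool}
    (h2 : ∀ a ∈ decNil (fstF y), sndF a = encodingPropForm.encode (decodeForm (sndF a))) :
    eOnlyFn (boolPair x y) = encodingPropForm.listBool.encode ((itemsOf y).map (extLine x.length)) := by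
  rw [FregeTransl.listBool_encode_eq, eOnlyFn, fanoutFn_apply, cntAFn_boolPair, elFn_eq h2, List.length_map]

/-- The first field of the translation of a code word is the unary length of the translation. -/
theorem fstF_translFn_encode (F : FregeSystem) (π : List (PropForm ℕ)) :
    fstF (translFn unitTable F.rules (encodingPropForm.listBool.encode π)) =
      List.replicate (translForms unitTable F.rules π).length true := by
  rw [translFn_encode, FregeTransl.listBool_encode_eq, fstF_boolPair]

/-- **C5 (with C2, C4) ⇒ every line is inferred** from the extension lines and the earlier lines. -/
theorem sound_c5 {F : FregeSystem} {x y : List Bool}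
    (h2 : ∀ a ∈ decNil (fstF y), sndF a = encodingPropForm.encode (decodeForm (sndF a)))
    (h4 : ∀ b ∈ decNil (sndF y), b = encodingPropForm.encode (decodeForm b))
    (h : c5Fn F (boolPair x y) = [true]) :
    ∀ (i : ℕ) (hi : i < (linesOf y).length),
      F.IsInferred ((itemsOf y).map (extLine x.length) ++ (linesOf y).take i) (linesOf y)[i] := by
  rw [c5Fn, Function.comp_apply, fanoutFn_apply, eqPairFn_boolPair_eq_true] at h
  simp only [Function.comp_apply] at h
  rw [fullFn_eq h2 h4, eOnlyFn_eq h2, extractProof, fstF_translFn_encode, fstF_translFn_encode, cntBFn_boolPair,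
    ← List.replicate_add] at h
  have hlen := congrArg List.length h
  simp only [List.length_replicate] at hlen
  exact (length_translForms_unitTable_append F _ _).2.1 hlen

/-- **C6 ⇒ the lines end with the input formula** (for an input code word). -/
theorem sound_c6 {φ : PropForm ℕ} {y : List Bool}
    (h : c6Fn (boolPair (encodingPropForm.encode φ) y) = [true]) : (linesOf y).getLast? = some φ := by
  rw [c6Fn, Function.comp_apply, fanoutFn_apply, eqPairFn_boolPair_eq_true, Function.comp_apply, xBFn_boolPair,
    lastItemFn_boolPair, decNil_encList, fstF_boolPair] at h
  have hne : encodingPropForm.encode φ ≠ [] := by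
    change boolPair _ _ ≠ []
    intro h0; have := congrArg List.length h0; rw [length_boolPair] at this; simp at this
  cases hl : (decNil (sndF y)).getLast? with
  | none => rw [hl] at h; exact absurd h.symm hne
  | some b =>
    rw [hl, Option.getD_some] at h
    rw [linesOf, List.getLast?_map, hl, Option.map_some, h, decodeForm_encode]

/-- **Soundness of the checker.** If the checker accepts `⟨encode φ, y⟩`, then the proof extracted
from `y` is an extended-Frege proof of `φ` over `F`, and `fullFn` computes its code. -/
theorem sound_chkFn {F : FregeSystem} {φ : PropForm ℕ} {y : List Bool}
    (h : chkFn F (boolPair (encodingPropForm.encode φ) y) = [true]) :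
    F.IsEFProofOf (extractProof (encodingPropForm.encode φ) y) φ ∧
      fullFn (boolPair (encodingPropForm.encode φ) y) =
        encodingPropForm.listBool.encode (extractProof (encodingPropForm.encode φ) y) := by
  obtain ⟨h2, h3, h4, h5, h6⟩ := (chkFn_eq_true_iff F _).1 h
  have H2 := sound_c2 h2
  have H4 := sound_c4 h4
  refine ⟨isEFProofOf_extLines_append (sound_c3 h3) ?_ (fun v hv => length_encodeNat_lt_length_encode hv)
    (sound_c5 (fun a ha => (H2 a ha).1) H4 h5) (sound_c6 h6), fullFn_eq (fun a ha => (H2 a ha).1) H4⟩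
  intro it hit v hv
  obtain ⟨a, ha, rfl⟩ := List.mem_map.1 hit
  exact (H2 a ha).2 v hv

end Checker
end Summit.PneNP.PneNP.Theorems.EFProofSearch
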